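import Summits.QuantumFields.BalabanUV.T4Continuum.Support.NE7StabiliserLiftingUniformOfPath
import Summits.QuantumFields.BalabanUV.T4Continuum.Support.NE7DataPathExp
import Summits.QuantumFields.BalabanUV.T4Continuum.Support.NE3CpushGaugeCovariance
import Literature.MathematicalPhysics.QuantumFieldTheory.Balaban1983to89.B7UnitaryAveragesAllRadii
import Literature.MathematicalPhysics.QuantumFieldTheory.Balaban1983to89.B7Prop6Flat
import HarnessLib

/-!
# NE7StabiliserLiftingUniformOfNearFlat — THE `k`-UNIFORM STABILISER LIFTING REDUCED TO A STATEMENT ABOUT COARSE DATA ONLY: the letter (PATH_K) of ✓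
# `NE7StabiliserLiftingUniformOfPath` is DISCHARGED by the SYMMETRIC CHORD from a nearby symmetric FLAT datum (F29 §2 with the principal logarithm, which is
# conjugation-equivariant), so the lifting with `∃ δ_V ∀ k` holds over every datum admitting an `ε′`-close FLAT datum with AT LEAST ITS SYMMETRY (`ε′ = ε′(ε, N)`, `k`-free)

Cell `pub-balaban`, rung (B)+1 sub-cell t4, lineage `b2b-balaban-t4-ne7b-p1` (row NE7b OWNER + CRUX PROVER; junction service for row NE7, ruling
R-OWNER-149-1 (2)), generation 159.  Memo `t4/b2b-balaban-t4-ne7b-p1/g159/records/SCOPING-uniform-lifting.md` (S3d + S6).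
THE CHORD.  For unitary `F`, `V` bondwise close (`‖F(b)⁻¹V(b) − 1‖ ≤ ε′ ≤ 1∕2`) put `X(b) := log(F(b)⁻¹V(b))` (the tree's principal logarithm `mlog`: skew by
✓ `B7UnitaryAveragesAllRadii.mlog_mem_skewAdjoint_of_mem_unitary`, `exp X = F⁻¹V` by ✓ `MatrixLog.exp_mlog`, `‖X‖ ≤ 2ε′` by ✓ `norm_mlog_le_two_mul`) and
`γ τ := F·e^{τX}` (F21 ✓ `NE7DataPathExp`: continuous, `γ 0 = F`, `γ 1 = V`, data `4(e^{2ε′} − 1)`-small over a flat `F`).  NEW: if a gauge field `s` fixes BOTH `F` and `V`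
then `F(b)⁻¹V(b)` commutes with `s(y)` (`y` the head of `b`), hence so does `X(b)` (✓ `B7Prop6Flat.mlog_conj`), and `γ τ` is fixed by `s` for every `τ` (✓ `vary_gaugeAct`).
So a FLAT `F` near `V₀` with `Stab(F) ⊇ Stab(V₀)` yields the symmetric small-data path (PATH_K) of the symmetric continuity method.
WHAT ([folklore]; 0 def, 0 sorry; §1–§2 generic `d`, §3 `d = 4`, every `U(n)`, `L ≥ 2`).  §1 `relUnit_conj_of_fixed`, `Ad_mlogRel_of_fixed`, `gaugeAct_chord_of_fixed`; §2
**`symmetric_path_of_nearFlat`**; §3 **`stabiliser_lifting_uniform_of_nearFlat`**: `∃ ε₀ ∀ 0<ε≤ε₀ ∀ N≥1 ∃ ε′>0 ∀ k ∀ V₀`: IF `V₀` (unitary, `N`-periodic) admits a unitary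
`N`-periodic FLAT `F` with `‖F(b)⁻¹V₀(b) − 1‖ ≤ ε′` on every bond and `F^s = F` for every unitary `N`-periodic `s` with `V₀^s = V₀`, THEN every minimiser `U` of
`sfClass 4 L N ε` at level `k+1` over `V₀` and every such `s` admit a unitary `(N·L^{k+1})`-periodic `h` with `U^h = U` and `h(L^{k+1}•z) = s(z)` — ✓ p824904's lifting with
`∃ ε′ ∀ k`, MODULO the near-flat symmetric datum (letter (NEAR-FLAT_K): «almost flat ⇒ near a flat datum at least as symmetric», F29 `exists_flat_near` inside the
fixed set — file S3 of the memo; pure coarse-lattice kinematics, no levels, no minimisers).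
HONEST FRAMING (page 1): composition of landed kernel theorems + the symmetric chord; (NEAR-FLAT_K) is NOT proved here; nothing of Bałaban's asserted; OUR minimisers ∕
OUR route; NOT NE7 as a spine node, NOT NE3; row NE7b NOT PRINTED ∕ NOT PROVED; spine 0∕9; finite T⁴ rung (B)+1 — NOT infinite volume, NOT mass gap, NOT BetaPertH, NOT
Clay (continuum YM on T⁴ ⇐ BetaPertH ∧ nine spine estimates).
-/

set_option autoImplicit false

open scoped BigOperators Matrix Matrix.Norms.L2Operator Topology
open NormedSpace Finset Set Filter

namespace Summit.QuantumFields.BalabanUV.T4Continuum.NE7StabiliserLiftingUniformOfNearFlat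

open Literature.MathematicalPhysics.QuantumFieldTheory.Balaban1983to89
open B7Prop1Explicit B7Prop2Explicit MatrixLog
open T4AveragingDeficitWall (IsUnitaryCfg IsSkewDir SmallField vary Ad)
open T4AveragingDeficitWallBoundary (IsPeriodicCfg)
open AveragingDeficitPeriodicCounting (IsPeriodicDir)
open AveragingDeficitNearIdentity (Ad_real_smul)
open MinimalActionSandwich (IsMinimiser)
open MinimalActionRate (sfClass)
open NE3EnergyShapes (IsUnitarySite IsPeriodicSite)
open NE3CpushGaugeCovariance (vary_gaugeAct)
open NE7DataPathExp (continuous_expPath expPath_zero expPath_one expPath_mem_sfClass₀)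
open B7UnitaryAveragesAllRadii (mlog_mem_skewAdjoint_of_mem_unitary)
open NE7StabiliserLiftingUniformOfPath (stabiliser_lifting_uniform_of_path)

noncomputable section

variable {d : ℕ} {n : Type} [Fintype n] [DecidableEq n]

/-! ## §1 The chord between two configurations fixed by a gauge field is fixed by it -/

/-- If `s` fixes the bond variables `F(b)` and `V(b)` (`s(x)F(b)s(y)⁻¹ = F(b)`, same for `V`, `b = (x, x+e_κ)`), then `F(b)⁻¹V(b)` commutes with `s(y)`. [folklore] -/
theorem relUnit_conj_of_fixed {F V : Site d → Fin d → (Matrix n n ℂ)ˣ} {s : Site d → (Matrix n n ℂ)ˣ} {x : Site d} {κ : Fin d}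
    (hF : s x * F x κ * (s (x + e κ))⁻¹ = F x κ) (hV : s x * V x κ * (s (x + e κ))⁻¹ = V x κ) :
    s (x + e κ) * ((F x κ)⁻¹ * V x κ) * (s (x + e κ))⁻¹ = (F x κ)⁻¹ * V x κ := by
  conv_rhs => rw [← hF, ← hV]
  group

/-- Hence the principal logarithm `X(b) = log(F(b)⁻¹V(b))` is `Ad_{s(y)}`-invariant (✓ `B7Prop6Flat.mlog_conj`). [folklore] -/
theorem Ad_mlogRel_of_fixed {F V : Site d → Fin d → (Matrix n n ℂ)ˣ} {s : Site d → (Matrix n n ℂ)ˣ} {x : Site d} {κ : Fin d}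
    (hF : s x * F x κ * (s (x + e κ))⁻¹ = F x κ) (hV : s x * V x κ * (s (x + e κ))⁻¹ = V x κ) :
    Ad (s (x + e κ)) (mlog ((((F x κ)⁻¹ * V x κ : (Matrix n n ℂ)ˣ)) : Matrix n n ℂ)) = mlog ((((F x κ)⁻¹ * V x κ : (Matrix n n ℂ)ˣ)) : Matrix n n ℂ) := by
  have h := relUnit_conj_of_fixed hF hV
  have hval : ((s (x + e κ) : (Matrix n n ℂ)ˣ) : Matrix n n ℂ) * ((((F x κ)⁻¹ * V x κ : (Matrix n n ℂ)ˣ)) : Matrix n n ℂ)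
      * (((s (x + e κ))⁻¹ : (Matrix n n ℂ)ˣ) : Matrix n n ℂ) = ((((F x κ)⁻¹ * V x κ : (Matrix n n ℂ)ˣ)) : Matrix n n ℂ) := by
    have h' := congrArg (fun w : (Matrix n n ℂ)ˣ => (w : Matrix n n ℂ)) h
    simpa only [Units.val_mul] using h'
  unfold Ad
  rw [← B7Prop6Flat.mlog_conj, hval]

/-- **THE CHORD BETWEEN TWO CONFIGURATIONS FIXED BY `s` IS FIXED BY `s`**: with `X(b) = log(F(b)⁻¹V(b))`, `(F·e^{τX})^s = F·e^{τX}` for every `τ`. [folklore] -/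
theorem gaugeAct_chord_of_fixed {F V : Site d → Fin d → (Matrix n n ℂ)ˣ} {s : Site d → (Matrix n n ℂ)ˣ} (hsF : gaugeAct s F = F) (hsV : gaugeAct s V = V)
    (τ : ℝ) :
    gaugeAct s (vary F (τ • fun x κ => mlog ((((F x κ)⁻¹ * V x κ : (Matrix n n ℂ)ˣ)) : Matrix n n ℂ)) 1)
      = vary F (τ • fun x κ => mlog ((((F x κ)⁻¹ * V x κ : (Matrix n n ℂ)ˣ)) : Matrix n n ℂ)) 1 := by
  have hdress : (fun x μ => Ad (s (x + e μ)) ((τ • fun x κ => mlog ((((F x κ)⁻¹ * V x κ : (Matrix n n ℂ)ˣ)) : Matrix n n ℂ)) x μ))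
      = τ • fun x κ => mlog ((((F x κ)⁻¹ * V x κ : (Matrix n n ℂ)ˣ)) : Matrix n n ℂ) := by
    funext x μ
    simp only [Pi.smul_apply]
    rw [Ad_real_smul, Ad_mlogRel_of_fixed (congr_fun (congr_fun hsF x) μ) (congr_fun (congr_fun hsV x) μ)]
  have h := vary_gaugeAct s F (τ • fun x κ => mlog ((((F x κ)⁻¹ * V x κ : (Matrix n n ℂ)ˣ)) : Matrix n n ℂ)) 1
  rw [hsF, hdress] at h
  exact h.symm

/-! ## §2 The symmetric small-data path from a nearby symmetric flat datum -/

/-- **(PATH_K) FROM A NEAR-FLAT DATUM AT LEAST AS SYMMETRIC.**  `V` unitary `N`-periodic; `F` unitary `N`-periodic FLAT (`SmallField F 0`) with `‖F(b)⁻¹V(b) − 1‖ ≤ ε′ ≤ 1∕2`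
on every bond and `F^s = F` for every unitary `N`-periodic `s` with `V^s = V`.  Then the chord `τ ↦ F·e^{τ log(F⁻¹V)}` is continuous on `[0,1]`, starts at the FLAT `F`, ends at
`V`, its values are unitary, `N`-periodic, `SmallField · 4(e^{2ε′} − 1)` and FIXED by every such `s`. [folklore] -/
theorem symmetric_path_of_nearFlat [Nonempty n] {N : ℕ} {V F : Site d → Fin d → (Matrix n n ℂ)ˣ}
    (hVu : IsUnitaryCfg V) (hVP : IsPeriodicCfg V (N : ℤ)) (hFu : IsUnitaryCfg F) (hFP : IsPeriodicCfg F (N : ℤ)) (hF0 : SmallField F 0)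
    {ε' : ℝ} (hε' : ε' ≤ 1 / 2)
    (hnear : ∀ (x : Site d) (κ : Fin d), ‖(((F x κ)⁻¹ : (Matrix n n ℂ)ˣ) : Matrix n n ℂ) * (V x κ : Matrix n n ℂ) - 1‖ ≤ ε')
    (hFfix : ∀ s : Site d → (Matrix n n ℂ)ˣ, IsUnitarySite s → IsPeriodicSite s (N : ℤ) → gaugeAct s V = V → gaugeAct s F = F) :
    ∃ γ : ℝ → (Site d → Fin d → (Matrix n n ℂ)ˣ), ContinuousOn γ (Icc (0 : ℝ) 1) ∧ γ 1 = V ∧ SmallField (γ 0) 0 ∧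
      ∀ τ ∈ Icc (0 : ℝ) 1, IsUnitaryCfg (γ τ) ∧ IsPeriodicCfg (γ τ) (N : ℤ) ∧ SmallField (γ τ) (4 * (Real.exp (2 * ε') - 1)) ∧
        ∀ s : Site d → (Matrix n n ℂ)ˣ, IsUnitarySite s → IsPeriodicSite s (N : ℤ) → gaugeAct s V = V → gaugeAct s (γ τ) = γ τ := by
  set X : Site d → Fin d → Matrix n n ℂ := fun x κ => mlog ((((F x κ)⁻¹ * V x κ : (Matrix n n ℂ)ˣ)) : Matrix n n ℂ) with hX
  have hWu : ∀ (x : Site d) (κ : Fin d), ((((F x κ)⁻¹ * V x κ : (Matrix n n ℂ)ˣ)) : Matrix n n ℂ) ∈ unitary (Matrix n n ℂ) := fun x κ =>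
    mem_unitaryUnits.mp ((unitaryUnits _).mul_mem ((unitaryUnits _).inv_mem (hFu x κ)) (hVu x κ))
  have hWval : ∀ (x : Site d) (κ : Fin d), ((((F x κ)⁻¹ * V x κ : (Matrix n n ℂ)ˣ)) : Matrix n n ℂ)
      = (((F x κ)⁻¹ : (Matrix n n ℂ)ˣ) : Matrix n n ℂ) * (V x κ : Matrix n n ℂ) := fun x κ => by simp only [Units.val_mul]
  have hXs : IsSkewDir X := fun x κ => mlog_mem_skewAdjoint_of_mem_unitary (hWu x κ)
  have hXP : IsPeriodicDir X (N : ℤ) := fun x i κ => by simp only [hX, hFP x i κ, hVP x i κ]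
  have hXβ : ∀ (x : Site d) (κ : Fin d), ‖X x κ‖ ≤ 2 * ε' := by
    intro x κ
    have h1 : ‖((((F x κ)⁻¹ * V x κ : (Matrix n n ℂ)ˣ)) : Matrix n n ℂ) - 1‖ ≤ 1 / 2 := by rw [hWval]; exact (hnear x κ).trans hε'
    have h2 := norm_mlog_le_two_mul h1
    rw [hWval] at h2
    calc ‖X x κ‖ ≤ 2 * ‖(((F x κ)⁻¹ : (Matrix n n ℂ)ˣ) : Matrix n n ℂ) * (V x κ : Matrix n n ℂ) - 1‖ := by rw [hX]; simpa only [hWval] using h2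
      _ ≤ 2 * ε' := by linarith [hnear x κ]
  refine ⟨fun τ => vary F (τ • X) 1, (continuous_expPath F X).continuousOn, ?_, ?_, fun τ hτ => ?_⟩
  · -- end point: `F·e^{log(F⁻¹V)} = V`
    show vary F ((1 : ℝ) • X) 1 = V
    rw [expPath_one]
    funext x κ
    refine Units.ext ?_
    have h1 : ‖((((F x κ)⁻¹ * V x κ : (Matrix n n ℂ)ˣ)) : Matrix n n ℂ) - 1‖ < 1 := by
      rw [hWval]; linarith [hnear x κ]
    have hexp : NormedSpace.exp (X x κ) = ((((F x κ)⁻¹ * V x κ : (Matrix n n ℂ)ˣ)) : Matrix n n ℂ) := exp_mlog h1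
    simp only [vary, Units.val_mul, val_expUnit, Complex.ofReal_one, one_smul, hexp]
    rw [← mul_assoc, Units.mul_inv, one_mul]
  · -- start point: the flat `F`
    show SmallField (vary F ((0 : ℝ) • X) 1) 0
    rw [expPath_zero F X]
    exact hF0
  · have hmem := expPath_mem_sfClass₀ (d := d) (n := n) 1 N hFu hFP hF0 hXs hXP hXβ hτ
    obtain ⟨hu, hP, hsm⟩ := hmem
    refine ⟨hu, by simpa using hP, ?_, fun s hsu hsP hsV => gaugeAct_chord_of_fixed (hFfix s hsu hsP hsV) hsV τ⟩
    have h : (0 + 4 * (Real.exp (2 * ε') - 1)) / (((1 : ℕ) : ℝ) ^ 0) ^ 2 = 4 * (Real.exp (2 * ε') - 1) := by norm_num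
    rw [h] at hsm
    exact hsm

/-! ## §3 The `k`-uniform lifting over every datum with a near-flat datum at least as symmetric (`d = 4`) -/

/-- **`k`-UNIFORM STABILISER LIFTING MODULO (NEAR-FLAT_K)** (`d = 4`, every `U(n)`, `L ≥ 2`; statement in the module docstring). [folklore] -/
theorem stabiliser_lifting_uniform_of_nearFlat [Nonempty n] {L : ℕ} (hL : 2 ≤ L) :
    ∃ ε₀ : ℝ, 0 < ε₀ ∧ ∀ ε : ℝ, 0 < ε → ε ≤ ε₀ → ∀ (N : ℕ) [NeZero N], 1 ≤ N → ∃ ε' : ℝ, 0 < ε' ∧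
      ∀ (k : ℕ) (V₀ : Site 4 → Fin 4 → (Matrix n n ℂ)ˣ), IsUnitaryCfg V₀ → IsPeriodicCfg V₀ (N : ℤ) →
        (∃ F : Site 4 → Fin 4 → (Matrix n n ℂ)ˣ, IsUnitaryCfg F ∧ IsPeriodicCfg F (N : ℤ) ∧ SmallField F 0 ∧
          (∀ (x : Site 4) (κ : Fin 4), ‖(((F x κ)⁻¹ : (Matrix n n ℂ)ˣ) : Matrix n n ℂ) * (V₀ x κ : Matrix n n ℂ) - 1‖ ≤ ε') ∧
          ∀ s : Site 4 → (Matrix n n ℂ)ˣ, IsUnitarySite s → IsPeriodicSite s (N : ℤ) → gaugeAct s V₀ = V₀ → gaugeAct s F = F) →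
        ∀ U : Site 4 → Fin 4 → (Matrix n n ℂ)ˣ, IsMinimiser 4 (sfClass 4 L N ε) L N (k + 1) V₀ U →
        ∀ s : Site 4 → (Matrix n n ℂ)ˣ, IsUnitarySite s → IsPeriodicSite s (N : ℤ) → gaugeAct s V₀ = V₀ →
          ∃ h : Site 4 → (Matrix n n ℂ)ˣ, IsUnitarySite h ∧ IsPeriodicSite h ((N * L ^ (k + 1) : ℕ) : ℤ) ∧ gaugeAct h U = U ∧
            ∀ z : Site 4, h (((L : ℤ) ^ (k + 1)) • z) = s z := by
  obtain ⟨ε₀, hε₀, H⟩ := stabiliser_lifting_uniform_of_path (n := n) hL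
  refine ⟨ε₀, hε₀, fun ε hε hεle N _ hN => ?_⟩
  obtain ⟨δV, hδV, H1⟩ := H ε hε hεle N hN
  -- the closeness `ε′` with `4(e^{2ε′} − 1) ≤ δ_V`
  have hlog : 0 < Real.log (1 + δV / 4) := Real.log_pos (by linarith)
  set ε' : ℝ := min (1 / 2) (Real.log (1 + δV / 4) / 2) with hε'
  have hε'0 : 0 < ε' := lt_min (by norm_num) (by linarith)
  have hε'h : ε' ≤ 1 / 2 := min_le_left _ _
  have hε'δ : 4 * (Real.exp (2 * ε') - 1) ≤ δV := by
    have h1 : 2 * ε' ≤ Real.log (1 + δV / 4) := by linarith [min_le_right (1 / 2 : ℝ) (Real.log (1 + δV / 4) / 2)]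
    have h2 : Real.exp (2 * ε') ≤ 1 + δV / 4 := by
      calc Real.exp (2 * ε') ≤ Real.exp (Real.log (1 + δV / 4)) := Real.exp_le_exp.mpr h1
        _ = 1 + δV / 4 := Real.exp_log (by linarith)
    linarith
  refine ⟨ε', hε'0, fun k V₀ hV₀u hV₀P hF U hU s hsu hsP hsfix => ?_⟩
  obtain ⟨F, hFu, hFP, hF0, hnear, hFfix⟩ := hF
  obtain ⟨γ, hγ, hγ1, hγ0, hγdata⟩ := symmetric_path_of_nearFlat (d := 4) hV₀u hV₀P hFu hFP hF0 hε'h hnear hFfix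
  exact H1 k V₀ γ hγ hγ1 (fun τ hτ => ⟨(hγdata τ hτ).1, (hγdata τ hτ).2.1, MinimalActionRate.SmallField.mono (hγdata τ hτ).2.2.1 hε'δ,
    (hγdata τ hτ).2.2.2⟩) hγ0 U hU s hsu hsP hsfix

end

end Summit.QuantumFields.BalabanUV.T4Continuum.NE7StabiliserLiftingUniformOfNearFlat
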